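import Mathlib

/-!
# drefute stmt-AtomisticToContinuum-11977 / line `sector-dirichlet-gluing` — the real-analysis shell of the stub set

Which combinations of the conclusions of `stub_flipPositiveConductance` (P: `D_N > 0`, `N ≥ 2`),
`stub_sigmaGluing` (S: `σ_{N+M} ≤ σ_N + σ_M + C`, `σ_N := (N-1)·D_N`) and `stub_resistanceGluing`
(R: `R_{N+M} ≤ R_N + R_M + C'`, `R_N := (N-1)/D_N`) decide clause (ii) (`D_N → s ∈ (0,∞)`), and which do not.

* `tendsto_pos_of_resistanceGluing_of_bdd` : R + P + (bounded response `D_N ≤ K`) ⇒ `D_N → s > 0`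
  — S is DISPENSABLE given the free sector bound `D_N(ε) ≤ C/ε` (NoisyBoundedResponse).
* `exists_sigmaGluing_pos_tendsto_zero` : S + P alone do NOT give a positive limit (`D_N = 1/N`).
* `exists_resistanceGluing_pos_unbounded` : R + P alone do NOT give a finite limit (`D_N = N`).
* `exists_tendsto_pos_not_sigmaGluing` : the O(1) form of S is NOT implied by the crux's conclusion:
  `D_N = 1 - 1/(⌊√N⌋+1) → 1`, `D_N > 0`, yet `σ_{2N} - 2σ_N` is unbounded (a `κ - c/√N` finite-size law
  kills S while the crux holds).
-/

open Filter Topology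

namespace Summit.AtomisticToContinuum.FouriersLaw.Cruxes.NoisyFourier.Drefute

/-! ## Fekete on `{n ≥ 2}` (copied from the skeleton `Lines/sector-dirichlet-gluing.lean`, proved there) -/

/-- Iterated subadditivity on `{n ≥ 2}`: `b (k·n + r) ≤ k·b n + b r` for `n, r ≥ 2` (copied from the
skeleton `Lines/sector-dirichlet-gluing.lean`). [folklore] -/
theorem apply_mul_add_le_of_two {b : ℕ → ℝ}
    (h : ∀ n m : ℕ, 2 ≤ n → 2 ≤ m → b (n + m) ≤ b n + b m)
    {n r : ℕ} (hn : 2 ≤ n) (hr : 2 ≤ r) (k : ℕ) :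
    b (k * n + r) ≤ k * b n + b r := by
  induction k with
  | zero => simp
  | succ k IH =>
    have h2 : 2 ≤ k * n + r := le_add_left hr
    calc b ((k + 1) * n + r) = b (n + (k * n + r)) := by congr 1; ring
      _ ≤ b n + b (k * n + r) := h n _ hn h2
      _ ≤ b n + (k * b n + b r) := by linarith
      _ = ((k + 1 : ℕ) : ℝ) * b n + b r := by push_cast; ring

/-- Fekete's lemma on the index semigroup `{n ≥ 2}`: a sequence subadditive there with `b n / n`
bounded below converges after division by `n` (copied from the skeleton). [folklore] -/
theorem fekete_Ici_two {b : ℕ → ℝ}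
    (h : ∀ n m : ℕ, 2 ≤ n → 2 ≤ m → b (n + m) ≤ b n + b m)
    {c : ℝ} (hc : ∀ n : ℕ, 2 ≤ n → c ≤ b n / n) :
    ∃ L : ℝ, Tendsto (fun n : ℕ => b n / n) atTop (𝓝 L) := by
  set S : Set ℝ := (fun n : ℕ => b n / n) '' Set.Ici 2 with hS_def
  have hne : S.Nonempty := ⟨b 2 / ((2 : ℕ) : ℝ), 2, Set.mem_Ici.2 le_rfl, rfl⟩
  have hbd : BddBelow S := ⟨c, by rintro _ ⟨n, hn, rfl⟩; exact hc n hn⟩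
  refine ⟨sInf S, tendsto_order.2 ⟨fun l hl => ?_, fun L hL => ?_⟩⟩
  · exact eventually_atTop.2 ⟨2, fun n hn => hl.trans_le (csInf_le hbd ⟨n, hn, rfl⟩)⟩
  · obtain ⟨x, ⟨n, hn, rfl⟩, hx⟩ := exists_lt_of_csInf_lt hne hL
    have hn2 : 2 ≤ n := hn
    have hn0 : n ≠ 0 := by omega
    refine Filter.Eventually.atTop_of_arithmetic hn0 fun r _ => ?_
    have hnr : 2 ≤ n + r := hn2.trans (Nat.le_add_right n r)
    have hnpos : (0 : ℝ) < (n : ℝ) := by exact_mod_cast Nat.pos_of_ne_zero hn0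
    have A : Tendsto (fun x : ℝ => (b n + b (n + r) / x) / ((n : ℝ) + ((n + r : ℕ) : ℝ) / x))
        atTop (𝓝 ((b n + 0) / ((n : ℝ) + 0))) :=
      ((tendsto_const_nhds.add (tendsto_const_nhds.div_atTop tendsto_id)).div
        (tendsto_const_nhds.add (tendsto_const_nhds.div_atTop tendsto_id))
        (by rw [add_zero]; exact hnpos.ne'))
    have B : Tendsto (fun x : ℝ => (x * b n + b (n + r)) / (x * (n : ℝ) + ((n + r : ℕ) : ℝ)))
        atTop (𝓝 (b n / n)) := by
      rw [add_zero, add_zero] at A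
      refine A.congr' ((eventually_ne_atTop 0).mono fun x hx => ?_)
      simp only [add_div' _ _ _ hx, div_div_div_cancel_right₀ hx, mul_comm]
    have C : Tendsto (fun k : ℕ => (((k - 1 : ℕ) : ℝ) * b n + b (n + r)) /
        (((k - 1 : ℕ) : ℝ) * (n : ℝ) + ((n + r : ℕ) : ℝ))) atTop (𝓝 (b n / n)) :=
      B.comp (tendsto_natCast_atTop_atTop.comp (tendsto_sub_atTop_nat 1))
    filter_upwards [C.eventually (gt_mem_nhds hx), eventually_ge_atTop 1] with k hk hk1
    have hid : n * k + r = (k - 1) * n + (n + r) := by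
      obtain ⟨j, rfl⟩ := Nat.exists_eq_add_of_le hk1
      rw [Nat.add_sub_cancel_left]
      ring
    have hcast : ((n * k + r : ℕ) : ℝ) = ((k - 1 : ℕ) : ℝ) * (n : ℝ) + ((n + r : ℕ) : ℝ) := by
      rw [hid]; push_cast; ring
    have hle : b (n * k + r) ≤ ((k - 1 : ℕ) : ℝ) * b n + b (n + r) := by
      rw [hid]; exact apply_mul_add_le_of_two h hn2 hnr (k - 1)
    have hden : (0 : ℝ) ≤ ((n * k + r : ℕ) : ℝ) := Nat.cast_nonneg _
    calc b (n * k + r) / ((n * k + r : ℕ) : ℝ)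
        ≤ (((k - 1 : ℕ) : ℝ) * b n + b (n + r)) / ((n * k + r : ℕ) : ℝ) :=
          div_le_div_of_nonneg_right hle hden
      _ = (((k - 1 : ℕ) : ℝ) * b n + b (n + r)) /
            (((k - 1 : ℕ) : ℝ) * (n : ℝ) + ((n + r : ℕ) : ℝ)) := by rw [hcast]
      _ < L := hk

/-- Fekete with an additive constant on `{n ≥ 2}`: `a (n+m) ≤ a n + a m + C` and `a n ≥ 0` give
convergence of `a n / n` to a limit `≥ 0` (copied from the skeleton). [folklore] -/
theorem fekete_quasi {a : ℕ → ℝ} {C : ℝ}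
    (h : ∀ n m : ℕ, 2 ≤ n → 2 ≤ m → a (n + m) ≤ a n + a m + C)
    (h0 : ∀ n : ℕ, 2 ≤ n → 0 ≤ a n) :
    ∃ L : ℝ, 0 ≤ L ∧ Tendsto (fun n : ℕ => a n / n) atTop (𝓝 L) := by
  set b : ℕ → ℝ := fun n => a n + C with hb
  have hsub : ∀ n m : ℕ, 2 ≤ n → 2 ≤ m → b (n + m) ≤ b n + b m := by
    intro n m hn hm
    simp only [hb]
    linarith [h n m hn hm]
  have hlow : ∀ n : ℕ, 2 ≤ n → -|C| ≤ b n / n := by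
    intro n hn
    have hn1 : (1 : ℝ) ≤ n := by exact_mod_cast (show 1 ≤ n by omega)
    have hnpos : (0 : ℝ) < n := by linarith
    have h1 : -|C| ≤ C / n := by
      rw [le_div_iff₀ hnpos]
      nlinarith [neg_abs_le C, abs_nonneg C]
    have h2 : C / n ≤ b n / n := by
      simp only [hb]
      exact div_le_div_of_nonneg_right (by linarith [h0 n hn]) hnpos.le
    exact h1.trans h2
  obtain ⟨L, hL⟩ := fekete_Ici_two hsub hlow
  have hC : Tendsto (fun n : ℕ => C / (n : ℝ)) atTop (𝓝 0) :=
    tendsto_const_nhds.div_atTop tendsto_natCast_atTop_atTop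
  have ha : Tendsto (fun n : ℕ => a n / n) atTop (𝓝 (L - 0)) := by
    refine (hL.sub hC).congr' ?_
    filter_upwards [eventually_ge_atTop 1] with n hn
    simp only [hb]
    ring
  rw [sub_zero] at ha
  refine ⟨L, ?_, ha⟩
  exact ge_of_tendsto ha (eventually_atTop.2 ⟨2, fun n hn =>
    div_nonneg (h0 n hn) (Nat.cast_nonneg n)⟩)

/-! ## (A) R-gluing + positivity + bounded response already decide clause (ii) — σ-gluing dispensable -/

/-- **`stub_sigmaGluing` is dispensable given a response CEILING.** If `D_N > 0` (`N ≥ 2`), `D_N ≤ K`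
(`N ≥ 2`; at `ε > 0` this is the free sector bound `σ_N ≤ ‖J_N‖²/2ε`, "NoisyBoundedResponse") and the
resistances `R_N = (N-1)/D_N` are quasi-subadditive on `{N ≥ 2}` (`stub_resistanceGluing`), then `D_N`
converges to a POSITIVE limit: Fekete gives `R_N/N → ℓ`, the ceiling gives `ℓ ≥ 1/K > 0`, and
`D_N = ((N-1)/N)/(R_N/N) → 1/ℓ`. So the stub sets {1,2,3,5 + ceiling} and {1,2,4 + floor} are each
complete; {4,5} are alternatives, not both needed. [folklore] -/
theorem tendsto_pos_of_resistanceGluing_of_bdd {D : ℕ → ℝ} (hpos : ∀ N : ℕ, 2 ≤ N → 0 < D N)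
    {K : ℝ} (hbdd : ∀ N : ℕ, 2 ≤ N → D N ≤ K) {C' : ℝ}
    (hR : ∀ N M : ℕ, 2 ≤ N → 2 ≤ M →
      (((N + M : ℕ) : ℝ) - 1) / D (N + M) ≤ ((N : ℝ) - 1) / D N + ((M : ℝ) - 1) / D M + C') :
    ∃ s : ℝ, 0 < s ∧ Tendsto D atTop (𝓝 s) := by
  set r : ℕ → ℝ := fun n => ((n : ℝ) - 1) / D n with hr
  have hsub : ∀ n m : ℕ, 2 ≤ n → 2 ≤ m → r (n + m) ≤ r n + r m + C' := fun n m hn hm => by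
    simpa only [hr] using hR n m hn hm
  have hr0 : ∀ n : ℕ, 2 ≤ n → 0 ≤ r n := fun n hn => by
    have h1 : (1 : ℝ) ≤ n := by exact_mod_cast (show 1 ≤ n by omega)
    exact div_nonneg (by linarith) (hpos n hn).le
  obtain ⟨ℓ, hℓ0, hℓ⟩ := fekete_quasi hsub hr0
  have hK : 0 < K := (hpos 2 le_rfl).trans_le (hbdd 2 le_rfl)
  -- lower bound r n / n ≥ ((n-1)/n) / K, whose limit is 1/K
  have hlow : ∀ᶠ n : ℕ in atTop, ((n : ℝ) - 1) / n / K ≤ r n / n := by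
    filter_upwards [eventually_ge_atTop 2] with n hn
    have hn2 : (2 : ℝ) ≤ n := by exact_mod_cast hn
    have hnpos : (0 : ℝ) < n := by linarith
    have hD := hpos n hn
    have hDK := hbdd n hn
    simp only [hr]
    rw [div_div, div_div]
    apply div_le_div_of_nonneg_left (by linarith) (by positivity) ?_
    nlinarith
  have hlim : Tendsto (fun n : ℕ => ((n : ℝ) - 1) / n / K) atTop (𝓝 (1 / K)) := by
    have h1 : Tendsto (fun n : ℕ => ((n : ℝ) - 1) / n) atTop (𝓝 1) := by
      have h : Tendsto (fun N : ℕ => (1 : ℝ) - 1 / (N : ℝ)) atTop (𝓝 (1 - 0)) :=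
        tendsto_const_nhds.sub tendsto_one_div_atTop_nhds_zero_nat
      rw [sub_zero] at h
      refine h.congr' ?_
      filter_upwards [eventually_ge_atTop 1] with N hN
      have hN : (0 : ℝ) < N := by exact_mod_cast hN
      field_simp
    simpa using h1.div_const K
  have hℓK : 1 / K ≤ ℓ := le_of_tendsto_of_tendsto hlim hℓ hlow
  have hℓpos : 0 < ℓ := lt_of_lt_of_le (by positivity) hℓK
  refine ⟨1 / ℓ, by positivity, ?_⟩
  have h1 : Tendsto (fun n : ℕ => ((n : ℝ) - 1) / n) atTop (𝓝 1) := by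
    have h : Tendsto (fun N : ℕ => (1 : ℝ) - 1 / (N : ℝ)) atTop (𝓝 (1 - 0)) :=
      tendsto_const_nhds.sub tendsto_one_div_atTop_nhds_zero_nat
    rw [sub_zero] at h
    refine h.congr' ?_
    filter_upwards [eventually_ge_atTop 1] with N hN
    have hN : (0 : ℝ) < N := by exact_mod_cast hN
    field_simp
  have h2 : Tendsto (fun n : ℕ => ((n : ℝ) - 1) / n / (r n / n)) atTop (𝓝 (1 / ℓ)) :=
    h1.div hℓ hℓpos.ne'
  refine h2.congr' ?_
  filter_upwards [eventually_ge_atTop 2] with n hn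
  have hn2 : (2 : ℝ) ≤ n := by exact_mod_cast hn
  have hn0 : (n : ℝ) ≠ 0 := by positivity
  have hn1 : (n : ℝ) - 1 ≠ 0 := by linarith
  have hD : D n ≠ 0 := (hpos n hn).ne'
  simp only [hr]
  field_simp

/-! ## (B) σ-gluing + positivity do NOT give a positive limit -/

/-- **Tightness of the stub set, I.** The conclusions of `stub_sigmaGluing` and
`stub_flipPositiveConductance` alone are compatible with an INSULATING limit: `D_N = 1/N` is positive,
`σ_N = (N-1)/N` is subadditive on `{N ≥ 2}` with constant `0`, and `D_N → 0`. Hence the line needs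
`stub_resistanceGluing` or the `ConductanceFloor` fallback; neither is decoration. [folklore] -/
theorem exists_sigmaGluing_pos_tendsto_zero :
    ∃ D : ℕ → ℝ, (∀ N : ℕ, 2 ≤ N → 0 < D N) ∧
      (∃ C : ℝ, ∀ N M : ℕ, 2 ≤ N → 2 ≤ M →
        (((N + M : ℕ) : ℝ) - 1) * D (N + M) ≤ ((N : ℝ) - 1) * D N + ((M : ℝ) - 1) * D M + C) ∧
      Tendsto D atTop (𝓝 0) := by
  refine ⟨fun N => 1 / (N : ℝ), fun N hN => by positivity, ⟨0, fun N M hN hM => ?_⟩,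
    tendsto_one_div_atTop_nhds_zero_nat⟩
  have hN : (2 : ℝ) ≤ N := by exact_mod_cast hN
  have hM : (2 : ℝ) ≤ M := by exact_mod_cast hM
  push_cast
  rw [show ((N : ℝ) + M - 1) * (1 / ((N : ℝ) + M)) = 1 - 1 / ((N : ℝ) + M) by field_simp,
    show ((N : ℝ) - 1) * (1 / (N : ℝ)) = 1 - 1 / (N : ℝ) by field_simp,
    show ((M : ℝ) - 1) * (1 / (M : ℝ)) = 1 - 1 / (M : ℝ) by field_simp]
  have h1 : 1 / (N : ℝ) ≤ 1 / 2 := by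
    rw [div_le_div_iff₀ (by positivity) (by positivity)]; linarith
  have h2 : 1 / (M : ℝ) ≤ 1 / 2 := by
    rw [div_le_div_iff₀ (by positivity) (by positivity)]; linarith
  have h3 : 0 < 1 / ((N : ℝ) + M) := by positivity
  linarith

/-! ## (C) R-gluing + positivity do NOT give a finite limit -/

/-- **Tightness of the stub set, II.** The conclusions of `stub_resistanceGluing` and
`stub_flipPositiveConductance` alone are compatible with a DIVERGING response: `D_N = N` is positive,
`R_N = (N-1)/N` is subadditive on `{N ≥ 2}` with constant `0`, and `D_N → ∞`. Hence, on the Thomson side,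
a response ceiling (σ-gluing, or the free bound `D_N ≤ C/ε`) is load-bearing. [folklore] -/
theorem exists_resistanceGluing_pos_unbounded :
    ∃ D : ℕ → ℝ, (∀ N : ℕ, 2 ≤ N → 0 < D N) ∧
      (∃ C : ℝ, ∀ N M : ℕ, 2 ≤ N → 2 ≤ M →
        (((N + M : ℕ) : ℝ) - 1) / D (N + M) ≤ ((N : ℝ) - 1) / D N + ((M : ℝ) - 1) / D M + C) ∧
      Tendsto D atTop atTop := by
  refine ⟨fun N => (N : ℝ), fun N hN => by positivity, ⟨0, fun N M hN hM => ?_⟩,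
    tendsto_natCast_atTop_atTop⟩
  have hN : (2 : ℝ) ≤ N := by exact_mod_cast hN
  have hM : (2 : ℝ) ≤ M := by exact_mod_cast hM
  push_cast
  rw [show ((N : ℝ) + M - 1) / ((N : ℝ) + M) = 1 - 1 / ((N : ℝ) + M) by field_simp,
    show ((N : ℝ) - 1) / (N : ℝ) = 1 - 1 / (N : ℝ) by field_simp,
    show ((M : ℝ) - 1) / (M : ℝ) = 1 - 1 / (M : ℝ) by field_simp]
  have h1 : 1 / (N : ℝ) ≤ 1 / 2 := by
    rw [div_le_div_iff₀ (by positivity) (by positivity)]; linarith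
  have h2 : 1 / (M : ℝ) ≤ 1 / 2 := by
    rw [div_le_div_iff₀ (by positivity) (by positivity)]; linarith
  have h3 : 0 < 1 / ((N : ℝ) + M) := by positivity
  linarith

/-! ## (D) the O(1) σ-gluing is a genuine strengthening of the crux's conclusion -/

/-- **`stub_sigmaGluing` can fail while clause (ii) holds.** With `D_N := 1 - 1/(Nat.sqrt N + 1)`
(`→ 1`, positive — a `κ - c/√N` finite-size law) the σ-defect at `N = M = m²` exceeds `m/2 - 2`, so no
constant `C` works: the O(1) series law is strictly stronger than `D_N → κ_ε > 0` and is killed by any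
approach to `κ_ε` from below slower than `1/N`. [folklore] -/
theorem exists_tendsto_pos_not_sigmaGluing :
    ∃ D : ℕ → ℝ, (∀ N : ℕ, 2 ≤ N → 0 < D N) ∧ Tendsto D atTop (𝓝 1) ∧
      ¬ ∃ C : ℝ, ∀ N M : ℕ, 2 ≤ N → 2 ≤ M →
        (((N + M : ℕ) : ℝ) - 1) * D (N + M) ≤ ((N : ℝ) - 1) * D N + ((M : ℝ) - 1) * D M + C := by
  refine ⟨fun N => 1 - 1 / ((Nat.sqrt N : ℝ) + 1), fun N _ => ?_, ?_, ?_⟩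
  · have h0 : (0 : ℝ) ≤ Nat.sqrt N := Nat.cast_nonneg _
    have : 1 / ((Nat.sqrt N : ℝ) + 1) ≤ 1 / (0 + 1) := by
      apply div_le_div_of_nonneg_left zero_le_one (by norm_num) (by linarith)
    have h1 : (1 : ℝ) ≤ Nat.sqrt N + 1 := by linarith
    have h2 : 1 / ((Nat.sqrt N : ℝ) + 1) < 1 ∨ 1 / ((Nat.sqrt N : ℝ) + 1) = 1 := by
      rcases h1.lt_or_eq with h | h
      · left; rw [div_lt_one (by linarith)]; exact h
      · right; rw [← h]; simp
    rcases h2 with h | h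
    · linarith
    · -- Nat.sqrt N = 0 forces N = 0 < 2: but we only need positivity; here 1 - 1 = 0 is excluded by N ≥ 2
      exfalso
      have hs : (Nat.sqrt N : ℝ) = 0 := by
        have := h1; field_simp at h; linarith
      have hs' : Nat.sqrt N = 0 := by exact_mod_cast hs
      rw [Nat.sqrt_eq_zero] at hs'
      omega
  · -- D → 1 - 0
    have h : Tendsto (fun N : ℕ => ((Nat.sqrt N : ℝ) + 1)) atTop atTop := by
      refine tendsto_atTop_add_const_right _ 1 ?_
      exact tendsto_natCast_atTop_atTop.comp (by
        refine Filter.tendsto_atTop_atTop.2 fun b => ⟨b * b, fun n hn => ?_⟩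
        calc b = Nat.sqrt (b * b) := (Nat.sqrt_eq b).symm
          _ ≤ Nat.sqrt n := Nat.sqrt_le_sqrt hn)
    have h2 : Tendsto (fun N : ℕ => 1 / ((Nat.sqrt N : ℝ) + 1)) atTop (𝓝 0) :=
      tendsto_const_nhds.div_atTop h
    simpa using (tendsto_const_nhds (x := (1 : ℝ))).sub h2
  · rintro ⟨C, hC⟩
    -- choose m with m/2 - 2 > C, N = M = m²
    obtain ⟨m0, hm0⟩ := exists_nat_gt (2 * C + 6)
    set m : ℕ := m0 + 2 with hm_def
    have hm2 : 2 ≤ m := by omega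
    have hm : (2 : ℝ) * C + 6 < m := by
      have : (m : ℝ) = m0 + 2 := by simp [hm_def]
      linarith
    have hN : 2 ≤ m * m := le_trans hm2 (Nat.le_mul_self m)
    have key := hC (m * m) (m * m) hN hN
    -- evaluate the square roots
    have hs1 : Nat.sqrt (m * m) = m := Nat.sqrt_eq m
    set k := Nat.sqrt (m * m + m * m) with hk
    have hk_up : k * k ≤ m * m + m * m := Nat.sqrt_le _
    have hk_low : m * m + m * m < (k + 1) * (k + 1) := Nat.lt_succ_sqrt _
    simp only [hs1] at key
    -- real casts
    have hmR : (2 : ℝ) ≤ m := by exact_mod_cast hm2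
    have hkR_up : (k : ℝ) * k ≤ (m : ℝ) * m + m * m := by exact_mod_cast hk_up
    have hkR_low : (m : ℝ) * m + m * m < ((k : ℝ) + 1) * (k + 1) := by exact_mod_cast hk_low
    have hk0 : (0 : ℝ) ≤ k := Nat.cast_nonneg _
    -- 2k < 3m from 4k² ≤ 8m² < 9m²
    have hk3 : (k : ℝ) < 3 / 2 * m := by nlinarith
    push_cast at key
    -- key : (m*m + m*m - 1) * (1 - 1/(k+1)) ≤ (m*m - 1) * (1 - 1/(m+1)) + (m*m-1)*(1 - 1/(m+1)) + C
    have e1 : ((m : ℝ) * m - 1) * (1 - 1 / ((m : ℝ) + 1)) = ((m : ℝ) - 1) * m := by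
      field_simp; ring
    have e2 : ((m : ℝ) * m + m * m - 1) * (1 - 1 / ((k : ℝ) + 1)) =
        ((m : ℝ) * m + m * m - 1) - ((m : ℝ) * m + m * m - 1) / ((k : ℝ) + 1) := by
      field_simp
    rw [e1, e2] at key
    -- bound the subtracted fraction by k + 1 using 2m² < (k+1)²
    have e3 : ((m : ℝ) * m + m * m - 1) / ((k : ℝ) + 1) ≤ (k : ℝ) + 1 := by
      rw [div_le_iff₀ (by positivity)]; nlinarith
    -- conclude: 2m² - 1 - (k+1) ≤ 2(m-1)m + C  ⇒  2m - k - 2 ≤ C ⇒ m/2 - 2 < C, contradiction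
    nlinarith

end Summit.AtomisticToContinuum.FouriersLaw.Cruxes.NoisyFourier.Drefute
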